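import Summits.CriticalPhenomena.PercolationContinuityZ3.Theorems.PercNearOneGluingNoHeavyLowerTailSahiSunflowerFourCubicLayerB
import Summits.CriticalPhenomena.PercolationContinuityZ3.Theorems.PercNearOneGluingNoHeavyLowerTailSahiHereditaryMeetAbsorption
import Mathlib.Tactic.FinCases
import HarnessLib

/-!
# `NoHeavyLowerTail` (crux stmt-CriticalPhenomena-4575), master-family line P2 (Sahi's algebraic route): **the `M₄` hierarchy theorem** —
# on the four-petal sunflower poset, Sahi positivity of EVERY order ⟺ `SahiPositive 2 ∧` the single quartic row

Support file (seat `prim-masterthm-p2`, gen 3; `--supports stmt-CriticalPhenomena-4575`); no named fact, no sorry.  Memo SAHI-ROUTE.md §4.10–4.12.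
Companions: `…SahiSunflowerFourPoint` (`M4`, closed form `M4.sahiE_four_D`, the row `FourPointLBRow`), `…SahiSunflowerFourHierarchy` (the 18 up-sets
`∅, univ, U S`; width `6`: `nested_of_seven`), `…SahiSunflowerFourCubicLayerA/B` (the nine LP certificates and `M4.sahiPositive_three_of_two_of_row`:
Harris + row ⟹ order `3`), and prim-l12-p5's `…SahiHereditaryMeetAbsorption` ("Theorem G": order `k` lifts to a `(k+1)`-family whose members
are monotone indicators one of which ABSORBS the product of the others, via the defect expansion "Theorem E").

**THEOREM (`M4.sahiPositive_iff_two_and_row`).**  For every probability weight `ν` on `M₄ = {core < pet 0, …, pet 3 < out}`: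
`(∀ n, SahiPositive ν n) ↔ SahiPositive ν 2 ∧ 0 ≤ E₄(χ_{D₀}, χ_{D₁}, χ_{D₂}, χ_{D₃})`,
`D_i = {pet j (j ≠ i), out}`; the right conjunct is `(1+a)(2+a)(ab − e₂(c)) − (2+a)e₃(c) − e₄(c) ≥ 0` in the cell masses (`M4.sahiE_four_D`).
This is the `m = 4` case of the numerical conjecture `S_m` of the memo (the `m = 3` case is `M3.sahiPositive_m3_iff`, where even the pair layer is
implied by the cubic); it was first decided by exact LP certificates for all 96 antichain families (this seat, kit j085689; independently ttrl cp-e4,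
96/96).  THE PROOF HERE NEEDS NO CERTIFICATE ABOVE ORDER `3`:

* ABSORPTION COMBINATORICS (`absI_four`, `absI_five`, kernel checks over the Sperner families of `[4]`): in every antichain family of `k ≥ 4` up-sets
  `U S₀, …, U S_{k−1}` of `M₄` OTHER THAN the row `{D₀, D₁, D₂, D₃}`, some member contains the intersection of the others (`S_p ⊇ ⋂_{j≠p} S_j`);
  for `k = 5, 6` the first member already does; there is no antichain of `7` (`nested_of_seven`).  (At `k = 3` the families WITHOUT an absorbing
  member are exactly the 26 "triangle-type" cubics `{X∖x ∪ T_x : x ∈ X}`, `|X| = 3` — the ones whose LP certificates use the row, `…CubicLayerA/B`;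
  at `k = 4` only `X = [4]`, the row itself.)
* Hence by Theorem G (`SahiHereditaryMeetAbsorption.sahiE_nonneg_of_sahiPositive_of_absorbing`): order `3` ⟹ every non-row antichain quartic,
  the row quartic is the hypothesis (up to a slot permutation, `sahiE_comp_perm`), nested quartics peel (`SahiCubeAllOrders.sahiE_setInd_nonneg_of_nested`)
  ⟹ order `4`; order `4` ⟹ order `5` ⟹ order `6` the same way; orders `≥ 7` by width `6` and the peel.
So on `M₄` the whole Sahi hierarchy is: Harris, the nine cubic certificates of `…CubicLayerA/B` (four of which consume the row), and the row.
(The quartic/quintic certificate files `…FourQuarticLayerA/B/C`, `…FourQuinticLayer` landed earlier remain as direct alternative proofs of those layers.)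
-/

namespace Summit.CriticalPhenomena.PercolationContinuityZ3.Theorems.SahiDeltaSystem
namespace M4
open Finset Function Literature.Combinatorics.Sahi2008

/-! ## Absorbing members: the combinatorics of Sperner families of `[4]` -/

set_option synthInstance.maxSize 8000 in
/-- **Antichain (Sperner) families of four subsets of `[4]`: either some member contains the intersection of the other three, or all four
members are `3`-sets (the family is the row `{[4]∖x : x}`)** (kernel check). [this work] -/
theorem absI_four : ∀ S₀ S₁ : Finset (Fin 4), ¬ S₀ ⊆ S₁ → ¬ S₁ ⊆ S₀ →
    ∀ S₂ : Finset (Fin 4), ¬ S₀ ⊆ S₂ → ¬ S₂ ⊆ S₀ → ¬ S₁ ⊆ S₂ → ¬ S₂ ⊆ S₁ →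
    ∀ S₃ : Finset (Fin 4), ¬ S₀ ⊆ S₃ → ¬ S₃ ⊆ S₀ → ¬ S₁ ⊆ S₃ → ¬ S₃ ⊆ S₁ → ¬ S₂ ⊆ S₃ → ¬ S₃ ⊆ S₂ →
    (∃ p : Fin 4, ∀ x : Fin 4, (∀ j : Fin 4, j ≠ p → x ∈ (![S₀, S₁, S₂, S₃] : Fin 4 → Finset (Fin 4)) j) →
        x ∈ (![S₀, S₁, S₂, S₃] : Fin 4 → Finset (Fin 4)) p) ∨ (S₀.card = 3 ∧ S₁.card = 3 ∧ S₂.card = 3 ∧ S₃.card = 3) := by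
  decide +kernel

set_option synthInstance.maxSize 8000 in
/-- **Antichain (Sperner) families of five subsets of `[4]`: the first member contains the intersection of the other four** (indeed all
members are `2`-sets and four distinct `2`-subsets of `[4]` have empty intersection; kernel check). [this work] -/
theorem absI_five : ∀ S₀ S₁ : Finset (Fin 4), ¬ S₀ ⊆ S₁ → ¬ S₁ ⊆ S₀ →
    ∀ S₂ : Finset (Fin 4), ¬ S₀ ⊆ S₂ → ¬ S₂ ⊆ S₀ → ¬ S₁ ⊆ S₂ → ¬ S₂ ⊆ S₁ →
    ∀ S₃ : Finset (Fin 4), ¬ S₀ ⊆ S₃ → ¬ S₃ ⊆ S₀ → ¬ S₁ ⊆ S₃ → ¬ S₃ ⊆ S₁ → ¬ S₂ ⊆ S₃ → ¬ S₃ ⊆ S₂ →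
    ∀ S₄ : Finset (Fin 4), ¬ S₀ ⊆ S₄ → ¬ S₄ ⊆ S₀ → ¬ S₁ ⊆ S₄ → ¬ S₄ ⊆ S₁ → ¬ S₂ ⊆ S₄ → ¬ S₄ ⊆ S₂ → ¬ S₃ ⊆ S₄ → ¬ S₄ ⊆ S₃ →
    ∀ x : Fin 4, (∀ j : Fin 5, j ≠ 0 → x ∈ (![S₀, S₁, S₂, S₃, S₄] : Fin 5 → Finset (Fin 4)) j) → x ∈ S₀ := by
  decide +kernel

/-! ## From index sets to up-sets of `M₄` -/

/-- `pet x ∈ U T ↔ x ∈ T`. [this work] -/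
@[simp] theorem pet_mem_U (T : Finset (Fin 4)) (x : Fin 4) : pet x ∈ U T ↔ x ∈ T := by
  simp [mem_U, pet_injective.eq_iff]

/-- `core ∉ U T`. [this work] -/
@[simp] theorem core_not_mem_U (T : Finset (Fin 4)) : core ∉ U T := by simp [mem_U]

/-- `out ∈ U T`. [this work] -/
@[simp] theorem out_mem_U (T : Finset (Fin 4)) : out ∈ U T := by simp [mem_U]

/-- In an antichain family of at least two up-sets of `M₄`, every member is some `U S` (`∅` and `univ` are comparable to everything). [this work] -/
theorem exists_eq_U_of_antichain {n : ℕ} (W : Fin (n + 2) → Finset M4) (hW : ∀ i, IsUpperSet ((W i : Finset M4) : Set M4))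
    (hanti : Pairwise fun i j => ¬ W j ⊆ W i) : ∃ S : Fin (n + 2) → Finset (Fin 4), ∀ i, W i = U (S i) := by
  have key : ∀ i, ∃ T : Finset (Fin 4), W i = U T := by
    intro i
    have hm : W i ∈ upsF := (isUp_iff_mem_upsF _).1 ((isUp_iff _).1 (hW i))
    simp only [upsF, Finset.mem_union, Finset.mem_insert, Finset.mem_singleton, Finset.mem_image, Finset.mem_univ,
      true_and] at hm
    obtain ⟨j, hj⟩ := exists_ne i
    rcases hm with (h | h) | ⟨T, hT⟩
    · exact absurd (h ▸ Finset.empty_subset (W j)) (hanti hj)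
    · exact absurd (h ▸ Finset.subset_univ (W j)) (hanti hj.symm)
    · exact ⟨T, hT.symm⟩
  choose S hS using key
  exact ⟨S, hS⟩

/-- The index sets of an antichain family of `U`-sets form an antichain. [this work] -/
theorem antichain_index {n : ℕ} {W : Fin n → Finset M4} {S : Fin n → Finset (Fin 4)} (hS : ∀ i, W i = U (S i))
    (hanti : Pairwise fun i j => ¬ W j ⊆ W i) : Pairwise fun i j => ¬ S j ⊆ S i :=
  fun _ _ hij h => hanti hij (by rw [hS, hS]; exact (U_subset_U_iff _ _).2 h)

/-- **An index set containing the intersection of the others gives an ABSORBING slot**: `(1 − χ_{U(S p)})·∏_{i ≠ p} χ_{U(S i)} = 0` pointwise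
on `M₄`. [this work] -/
theorem absorbs_of_absI {n : ℕ} (S : Fin (n + 2) → Finset (Fin 4)) (p : Fin (n + 2))
    (hp : ∀ x : Fin 4, (∀ j, j ≠ p → x ∈ S j) → x ∈ S p) (a : M4) :
    (1 - setInd (U (S p)) a) * ∏ i ∈ Finset.univ.erase p, setInd (U (S i)) a = 0 := by
  by_cases ha : a ∈ U (S p)
  · simp [setInd_apply, ha]
  · have key : ∃ j, j ≠ p ∧ a ∉ U (S j) := by
      rcases a with _ | x | _
      · obtain ⟨j, hj⟩ := exists_ne p
        exact ⟨j, hj, core_not_mem_U _⟩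
      · by_contra h
        push Not at h
        exact ha ((pet_mem_U _ _).2 (hp x fun j hj => (pet_mem_U _ _).1 (h j hj)))
      · exact absurd (out_mem_U _) ha
    obtain ⟨j, hjp, hj⟩ := key
    rw [Finset.prod_eq_zero (Finset.mem_erase.2 ⟨hjp, Finset.mem_univ j⟩) (by simp [setInd_apply, hj]), mul_zero]

/-- **Theorem G applied**: order `n + 1` of the weight and an absorbing index set give `E_{n+2} ≥ 0` for the `U`-family. [this work] -/
theorem sahiE_setInd_U_nonneg_of_absI {ν : M4 → ℝ} (hν0 : ∀ x, 0 ≤ ν x) (hν1 : ∑ x, ν x = 1) {n : ℕ}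
    (hS : SahiPositive ν (n + 1)) (S : Fin (n + 2) → Finset (Fin 4)) {p : Fin (n + 2)}
    (hp : ∀ x : Fin 4, (∀ j, j ≠ p → x ∈ S j) → x ∈ S p) :
    0 ≤ sahiE ν (n + 2) (fun i => setInd (U (S i))) := by
  refine SahiHereditaryMeetAbsorption.sahiE_nonneg_of_sahiPositive_of_absorbing hν0 hν1 (Nat.succ_pos n) hS (n + 2) _
    (fun i a => ?_) (fun i => monotone_setInd (isUpperSet_U (S i))) (fun T hT => ?_)
  · rw [setInd_apply]; split_ifs <;> simp
  · have hTu : T = Finset.univ :=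
      Finset.eq_univ_of_card T (le_antisymm (Finset.card_le_univ T) (by rw [Fintype.card_fin]; omega))
    subst hTu
    exact ⟨p, Finset.mem_univ p, absorbs_of_absI S p hp⟩

/-! ## The row, up to a slot permutation -/

/-- The `3`-subsets of `[4]` are the co-singletons (kernel check). [this work] -/
theorem exists_eq_erase_of_card_eq_three : ∀ T : Finset (Fin 4), T.card = 3 → ∃ k : Fin 4, T = Finset.univ.erase k := by
  decide

/-- **An antichain of four `3`-subsets indexes a slot permutation of the row**, so its `E₄` is the row quartic. [this work] -/
theorem sahiE_setInd_U_nonneg_of_card_three {ν : M4 → ℝ}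
    (h4 : 0 ≤ sahiE ν 4 ![setInd (D 0), setInd (D 1), setInd (D 2), setInd (D 3)])
    (S : Fin 4 → Finset (Fin 4)) (hanti : Pairwise fun i j => ¬ S j ⊆ S i) (h3 : ∀ i, (S i).card = 3) :
    0 ≤ sahiE ν 4 (fun i => setInd (U (S i))) := by
  choose k hk using fun i => exists_eq_erase_of_card_eq_three (S i) (h3 i)
  have hk' : ∀ i, U (S i) = D (k i) := fun i => by rw [hk i, D_eq_U]
  have hinj : Function.Injective k := by
    intro i j hij
    by_contra hne
    refine hanti hne ?_
    rw [hk j, hk i, hij]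
  obtain ⟨σ, hσ⟩ : ∃ σ : Equiv.Perm (Fin 4), ∀ i, σ i = k i :=
    ⟨Equiv.ofBijective k (Finite.injective_iff_bijective.1 hinj), fun _ => rfl⟩
  have e : (fun i => setInd (U (S i))) = fun i => (fun j => setInd (D j)) (σ i) := by
    funext i; rw [hk', hσ]
  rw [e, sahiE_comp_perm ν 4 σ (fun j => setInd (D j))]
  have e2 : (fun j => setInd (D j)) = ![setInd (D 0), setInd (D 1), setInd (D 2), setInd (D 3)] := by
    funext j; fin_cases j <;> rfl
  rw [e2]; exact h4

/-! ## The layers `4, 5, 6` and all orders -/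

/-- **Order `4` from Harris and the row**: `E₄ ≥ 0` for every four up-sets of `M₄`. [this work] -/
theorem sahiE_four_setInd_nonneg_of_two_of_row {ν : M4 → ℝ} (hν0 : ∀ x, 0 ≤ ν x) (hν1 : ∑ x, ν x = 1) (hS2 : SahiPositive ν 2)
    (h4 : 0 ≤ sahiE ν 4 ![setInd (D 0), setInd (D 1), setInd (D 2), setInd (D 3)])
    (W : Fin 4 → Finset M4) (hW : ∀ i, IsUpperSet ((W i : Finset M4) : Set M4)) : 0 ≤ sahiE ν 4 (fun i => setInd (W i)) := by
  have hS3 := sahiPositive_three_of_two_of_row hν0 hν1 hS2 h4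
  by_cases hanti : Pairwise fun i j => ¬ W j ⊆ W i
  · obtain ⟨S, hS⟩ := exists_eq_U_of_antichain W hW hanti
    have hWS : (fun i => setInd (W i)) = fun i => setInd (U (S i)) := by funext i; rw [hS]
    rw [hWS]
    have hSa := antichain_index hS hanti
    have hv : (![S 0, S 1, S 2, S 3] : Fin 4 → Finset (Fin 4)) = S := by funext i; fin_cases i <;> rfl
    rcases absI_four (S 0) (S 1) (hSa (by decide)) (hSa (by decide)) (S 2) (hSa (by decide)) (hSa (by decide))
        (hSa (by decide)) (hSa (by decide)) (S 3) (hSa (by decide)) (hSa (by decide)) (hSa (by decide)) (hSa (by decide))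
        (hSa (by decide)) (hSa (by decide)) with ⟨p, hp⟩ | ⟨h0, h1, h2, h3⟩
    · rw [hv] at hp
      exact sahiE_setInd_U_nonneg_of_absI hν0 hν1 hS3 S hp
    · exact sahiE_setInd_U_nonneg_of_card_three h4 S hSa (fun i => by fin_cases i <;> assumption)
  · unfold Pairwise at hanti
    push Not at hanti
    obtain ⟨i, j, hij, hsub⟩ := hanti
    exact SahiCubeAllOrders.sahiE_setInd_nonneg_of_nested hν0 hν1 ((sahiPositive_iff_indicators ν 3).1 hS3) W hW hij hsub

/-- **Theorem (`M₄`, quartic layer): Harris + the quartic row ⟹ Sahi positivity of order `4`.** [this work] -/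
theorem sahiPositive_four_of_two_of_row {ν : M4 → ℝ} (hν0 : ∀ x, 0 ≤ ν x) (hν1 : ∑ x, ν x = 1) (hS2 : SahiPositive ν 2)
    (h4 : 0 ≤ sahiE ν 4 ![setInd (D 0), setInd (D 1), setInd (D 2), setInd (D 3)]) : SahiPositive ν 4 :=
  (sahiPositive_iff_indicators ν 4).2 fun W hW => sahiE_four_setInd_nonneg_of_two_of_row hν0 hν1 hS2 h4 W hW

/-- **Order `5` from Harris and the row**: `E₅ ≥ 0` for every five up-sets of `M₄` (an antichain of five has an absorbing member; Theorem G
from order `4`). [this work] -/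
theorem sahiE_five_setInd_nonneg_of_two_of_row {ν : M4 → ℝ} (hν0 : ∀ x, 0 ≤ ν x) (hν1 : ∑ x, ν x = 1) (hS2 : SahiPositive ν 2)
    (h4 : 0 ≤ sahiE ν 4 ![setInd (D 0), setInd (D 1), setInd (D 2), setInd (D 3)])
    (W : Fin 5 → Finset M4) (hW : ∀ i, IsUpperSet ((W i : Finset M4) : Set M4)) : 0 ≤ sahiE ν 5 (fun i => setInd (W i)) := by
  have hS4 := sahiPositive_four_of_two_of_row hν0 hν1 hS2 h4
  by_cases hanti : Pairwise fun i j => ¬ W j ⊆ W i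
  · obtain ⟨S, hS⟩ := exists_eq_U_of_antichain W hW hanti
    have hWS : (fun i => setInd (W i)) = fun i => setInd (U (S i)) := by funext i; rw [hS]
    rw [hWS]
    have hSa := antichain_index hS hanti
    have hv : (![S 0, S 1, S 2, S 3, S 4] : Fin 5 → Finset (Fin 4)) = S := by funext i; fin_cases i <;> rfl
    have hp := absI_five (S 0) (S 1) (hSa (by decide)) (hSa (by decide)) (S 2) (hSa (by decide)) (hSa (by decide))
      (hSa (by decide)) (hSa (by decide)) (S 3) (hSa (by decide)) (hSa (by decide)) (hSa (by decide)) (hSa (by decide))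
      (hSa (by decide)) (hSa (by decide)) (S 4) (hSa (by decide)) (hSa (by decide)) (hSa (by decide)) (hSa (by decide))
      (hSa (by decide)) (hSa (by decide)) (hSa (by decide)) (hSa (by decide))
    rw [hv] at hp
    exact sahiE_setInd_U_nonneg_of_absI hν0 hν1 hS4 S hp
  · unfold Pairwise at hanti
    push Not at hanti
    obtain ⟨i, j, hij, hsub⟩ := hanti
    exact SahiCubeAllOrders.sahiE_setInd_nonneg_of_nested hν0 hν1 ((sahiPositive_iff_indicators ν 4).1 hS4) W hW hij hsub

/-- **Harris + the quartic row ⟹ Sahi positivity of order `5`.** [this work] -/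
theorem sahiPositive_five_of_two_of_row {ν : M4 → ℝ} (hν0 : ∀ x, 0 ≤ ν x) (hν1 : ∑ x, ν x = 1) (hS2 : SahiPositive ν 2)
    (h4 : 0 ≤ sahiE ν 4 ![setInd (D 0), setInd (D 1), setInd (D 2), setInd (D 3)]) : SahiPositive ν 5 :=
  (sahiPositive_iff_indicators ν 5).2 fun W hW => sahiE_five_setInd_nonneg_of_two_of_row hν0 hν1 hS2 h4 W hW

/-- **Order `6` from Harris and the row**: `E₆ ≥ 0` for every six up-sets of `M₄` (the only antichain of six is the family of all `2`-subset
`U`-sets, whose first member absorbs; Theorem G from order `5`). [this work] -/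
theorem sahiE_six_setInd_nonneg_of_two_of_row {ν : M4 → ℝ} (hν0 : ∀ x, 0 ≤ ν x) (hν1 : ∑ x, ν x = 1) (hS2 : SahiPositive ν 2)
    (h4 : 0 ≤ sahiE ν 4 ![setInd (D 0), setInd (D 1), setInd (D 2), setInd (D 3)])
    (W : Fin 6 → Finset M4) (hW : ∀ i, IsUpperSet ((W i : Finset M4) : Set M4)) : 0 ≤ sahiE ν 6 (fun i => setInd (W i)) := by
  have hS5 := sahiPositive_five_of_two_of_row hν0 hν1 hS2 h4
  by_cases hanti : Pairwise fun i j => ¬ W j ⊆ W i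
  · obtain ⟨S, hS⟩ := exists_eq_U_of_antichain W hW hanti
    have hWS : (fun i => setInd (W i)) = fun i => setInd (U (S i)) := by funext i; rw [hS]
    rw [hWS]
    have hSa := antichain_index hS hanti
    have h5 := absI_five (S 0) (S 1) (hSa (by decide)) (hSa (by decide)) (S 2) (hSa (by decide)) (hSa (by decide))
      (hSa (by decide)) (hSa (by decide)) (S 3) (hSa (by decide)) (hSa (by decide)) (hSa (by decide)) (hSa (by decide))
      (hSa (by decide)) (hSa (by decide)) (S 4) (hSa (by decide)) (hSa (by decide)) (hSa (by decide)) (hSa (by decide))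
      (hSa (by decide)) (hSa (by decide)) (hSa (by decide)) (hSa (by decide))
    have hp : ∀ x : Fin 4, (∀ j, j ≠ (0 : Fin 6) → x ∈ S j) → x ∈ S 0 := by
      intro x hx
      have hx' : ∀ j : Fin 5, j ≠ 0 → x ∈ (![S 0, S 1, S 2, S 3, S 4] : Fin 5 → Finset (Fin 4)) j := by
        intro j hj
        fin_cases j
        · exact absurd rfl hj
        · exact hx 1 (by decide)
        · exact hx 2 (by decide)
        · exact hx 3 (by decide)
        · exact hx 4 (by decide)
      exact h5 x hx'
    exact sahiE_setInd_U_nonneg_of_absI hν0 hν1 hS5 S hp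
  · unfold Pairwise at hanti
    push Not at hanti
    obtain ⟨i, j, hij, hsub⟩ := hanti
    exact SahiCubeAllOrders.sahiE_setInd_nonneg_of_nested hν0 hν1 ((sahiPositive_iff_indicators ν 5).1 hS5) W hW hij hsub

/-- **Harris + the quartic row ⟹ Sahi positivity of order `6`.** [this work] -/
theorem sahiPositive_six_of_two_of_row {ν : M4 → ℝ} (hν0 : ∀ x, 0 ≤ ν x) (hν1 : ∑ x, ν x = 1) (hS2 : SahiPositive ν 2)
    (h4 : 0 ≤ sahiE ν 4 ![setInd (D 0), setInd (D 1), setInd (D 2), setInd (D 3)]) : SahiPositive ν 6 :=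
  (sahiPositive_iff_indicators ν 6).2 fun W hW => sahiE_six_setInd_nonneg_of_two_of_row hν0 hν1 hS2 h4 W hW

/-- **Orders `≥ 6` from Harris and the row**, indicator form: the up-set lattice of `M₄` has width `6`, so every family of `≥ 7` up-sets has a
nested pair and peels. [this work] -/
theorem sahiE_setInd_nonneg_of_two_of_row_ge_six {ν : M4 → ℝ} (hν0 : ∀ x, 0 ≤ ν x) (hν1 : ∑ x, ν x = 1) (hS2 : SahiPositive ν 2)
    (h4 : 0 ≤ sahiE ν 4 ![setInd (D 0), setInd (D 1), setInd (D 2), setInd (D 3)]) :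
    ∀ (k : ℕ) (W : Fin (k + 6) → Finset M4), (∀ i, IsUpperSet ((W i : Finset M4) : Set M4)) →
      0 ≤ sahiE ν (k + 6) (fun i => setInd (W i)) := by
  intro k
  induction k with
  | zero => exact fun W hW => sahiE_six_setInd_nonneg_of_two_of_row hν0 hν1 hS2 h4 W hW
  | succ k ih =>
    intro W hW
    obtain ⟨i, j, hij, hsub⟩ := nested_of_seven W hW
    exact SahiCubeAllOrders.sahiE_setInd_nonneg_of_nested hν0 hν1 ih W hW hij hsub

/-- **Harris + the quartic row ⟹ Sahi positivity of EVERY order on `M₄`.** [this work] -/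
theorem sahiPositive_of_two_of_row {ν : M4 → ℝ} (hν0 : ∀ x, 0 ≤ ν x) (hν1 : ∑ x, ν x = 1) (hS2 : SahiPositive ν 2)
    (h4 : 0 ≤ sahiE ν 4 ![setInd (D 0), setInd (D 1), setInd (D 2), setInd (D 3)]) (n : ℕ) : SahiPositive ν n := by
  match n with
  | 0 => exact sahiPositive_zero ν
  | 1 => exact sahiPositive_one hν0
  | 2 => exact hS2
  | 3 => exact sahiPositive_three_of_two_of_row hν0 hν1 hS2 h4
  | 4 => exact sahiPositive_four_of_two_of_row hν0 hν1 hS2 h4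
  | 5 => exact sahiPositive_five_of_two_of_row hν0 hν1 hS2 h4
  | k + 6 => exact (sahiPositive_iff_indicators ν (k + 6)).2 (sahiE_setInd_nonneg_of_two_of_row_ge_six hν0 hν1 hS2 h4 k)

/-- **THE `M₄` HIERARCHY THEOREM.**  For every probability weight on the four-petal sunflower poset `M₄`:
Sahi positivity of every order ⟺ `SahiPositive ν 2 ∧ 0 ≤ E₄(χ_{D₀}, χ_{D₁}, χ_{D₂}, χ_{D₃})`
(`= (1+a)(2+a)(ab − e₂(c)) − (2+a)e₃(c) − e₄(c)`, `M4.sahiE_four_D`): the single QUARTIC row carries the whole hierarchy above the pair layer —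
the `m = 4` case of conjecture `S_m` (memo SAHI-ROUTE §4.10(c); `m = 3`: `M3.sahiPositive_m3_iff`). [this work] -/
theorem sahiPositive_iff_two_and_row {ν : M4 → ℝ} (hν0 : ∀ x, 0 ≤ ν x) (hν1 : ∑ x, ν x = 1) :
    (∀ n, SahiPositive ν n) ↔
      SahiPositive ν 2 ∧ 0 ≤ sahiE ν 4 ![setInd (D 0), setInd (D 1), setInd (D 2), setInd (D 3)] := by
  constructor
  · intro h
    refine ⟨h 2, ?_⟩
    have key := (sahiPositive_iff_indicators ν 4).1 (h 4) ![D 0, D 1, D 2, D 3] (fun i => by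
      fin_cases i <;> exact isUpperSet_D _)
    have e : (fun i => setInd ((![D 0, D 1, D 2, D 3] : Fin 4 → Finset M4) i)) =
        ![setInd (D 0), setInd (D 1), setInd (D 2), setInd (D 3)] := by
      funext i; fin_cases i <;> rfl
    rw [e] at key
    exact key
  · rintro ⟨hS2, h4⟩ n
    exact sahiPositive_of_two_of_row hν0 hν1 hS2 h4 n

end M4
end Summit.CriticalPhenomena.PercolationContinuityZ3.Theorems.SahiDeltaSystem
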